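import Literature.Geometry.GeometricMeasureTheory.ClosureTheorem
import HarnessLib

/-!
# Weak limits of cycles with rectifiable sphere slices are rectifiable

B. White's structure-theorem-free proof of the closure theorem [White1989] shows that a weak limit
of rectifiable cycles of bounded mass is rectifiable; of the approximating cycles `Zᵢ` the proof
only ever uses that their sphere slices `∂(Zᵢ ⌞ 𝐁(x,r))` are rectifiable `k`-currents for almost
every radius (in `LimitSlicesRectifiable.lean` this is obtained from the deformation theorem via
integral polyhedral approximants). This file records the resulting stronger statement, which is
the form needed for the boundary rectifiability theorem [Federer1969, 4.2.16 (2)] (the approximants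
there are the images of `∂S` under the cubical retractions, cycles that are not known to be
rectifiable, but whose slices are boundaries of slices of rectifiable currents one dimension up):

* `Current.isRectifiable_of_tendsto_boundaries` — the induction hypothesis of White's argument
  ("weak limits of rectifiable `k`-dimensional boundaries of bounded mass and support are
  rectifiable") holds outright, by the closure theorem `Current.isRectifiable_of_tendsto_integral`;
* `Current.ae_isRectifiable_boundary_piece_of_tendsto_of_slices` — if cycles `Zᵢ` of bounded mass
  supported in a compact set, each with a.e. rectifiable sphere slices around every centre, converge
  weakly to `T`, then for every centre `x` and a.e. `r > 0` the slice `∂(T ⌞ 𝐁(x,r))` is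
  rectifiable (White's slicing lemma, p. 208, and the induction hypothesis, as in
  `Current.ae_isRectifiable_boundary_piece_of_tendsto` but without the polyhedral detour);
* **`Current.isRectifiable_of_tendsto_cycles_of_slices`** — hence `T` is a rectifiable current
  (`Current.isRectifiable_of_cycle_of_slices`, `ClosureTheoremCycles.lean`);
* `Current.isRectifiable_of_cycle_of_slices'` — the constant-sequence case: a finite-mass compactly
  supported cycle with a.e. rectifiable sphere slices is rectifiable, with no induction hypothesis.

Theorems only; no definitions, no named facts.

## References

* B. White, *A new proof of the compactness theorem for integral currents*, Comment. Math. Helv.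
  64 (1989) 207–220, §1.2 (slicing lemma), §1.5, Theorem p. 211 [White1989].
* H. Federer, *Geometric Measure Theory*, Springer 1969, 4.2.1, 4.2.16 [Federer1969].
-/

noncomputable section

open scoped Distributions ENNReal NNReal Topology
open MeasureTheory TopologicalSpace Set Filter Metric Function Module

namespace Literature.Geometry.GeometricMeasureTheory

-- Nested operator-norm instances on (duals of) `V [⋀^Fin m]→L[ℝ] ℝ`, as in `Currents.lean`.
set_option maxSynthPendingDepth 2

variable {V : Type*} [NormedAddCommGroup V] [InnerProductSpace ℝ V] [FiniteDimensional ℝ V]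
  [MeasurableSpace V] [BorelSpace V] {k : ℕ}

/-! ### The induction hypothesis holds outright -/

section IH

/-- **Weak limits of rectifiable boundaries are rectifiable**: if `Qᵢ` are `(k+1)`-currents whose
boundaries are rectifiable with `spt ∂Qᵢ ⊆ K'` compact and `𝐌(∂Qᵢ) ≤ c' < ∞`, and `∂Qᵢ → Z'`
weakly, then `Z'` is rectifiable — the closure theorem [Federer1969, 4.2.16 (1)] for the integral
cycles `∂Qᵢ` (`𝐍(∂Qᵢ) = 𝐌(∂Qᵢ)`). This is the induction hypothesis `IH` of White's argument
(`LimitSlicesRectifiable.lean`, `ClosureTheoremCycles.lean`), discharged.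
[cite: Federer1969, 4.2.16 (1); White1989, Theorem p. 207] -/
theorem Current.isRectifiable_of_tendsto_boundaries (k : ℕ) (K' : Set V) (hK' : IsCompact K')
    (c' : ℝ≥0∞) (hc' : c' ≠ ⊤) (Q : ℕ → Current (⊤ : Opens V) (k + 1)) (Z' : Current (⊤ : Opens V) k)
    (hQ : ∀ i, (Q i).boundary.IsRectifiable ∧ (Q i).boundary.support ⊆ K' ∧
      (Q i).boundary.mass ≤ c')
    (hQc : ∀ φ, Tendsto (fun i => (Q i).boundary φ) atTop (𝓝 (Z' φ))) : Z'.IsRectifiable := by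
  cases k with
  | zero =>
    exact Current.isRectifiable_of_tendsto_zero hK' hc' (T := fun i => (Q i).boundary)
      (fun i => ⟨(hQ i).1, (hQ i).2.1, (hQ i).2.2⟩) hQc
  | succ k' =>
    refine Current.isRectifiable_of_tendsto_integral k' hK' hc' (T := fun i => (Q i).boundary)
      (fun i => ⟨⟨(hQ i).1, ?_⟩, (hQ i).2.1, ?_⟩) hQc
    · rw [Current.boundary_boundary]
      exact Current.isRectifiable_zero
    · show (Q i).boundary.mass + (Q i).boundary.boundary.mass ≤ c'
      rw [Current.boundary_boundary, Current.mass_zero, add_zero]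
      exact (hQ i).2.2

end IH

/-! ### Slices of weak limits of sliceable cycles -/

section Slices

/-- **Sphere slices of a weak limit of cycles with rectifiable slices are rectifiable** (White's
slicing step without the polyhedral detour): let `Zᵢ` be `(k+1)`-cycles with `spt Zᵢ ⊆ K` compact
and `𝐌(Zᵢ) ≤ c < ∞`, such that for every `i`, every centre `x` and almost every `r > 0` the slice
`∂(Zᵢ ⌞ 𝐁(x,r))` is a rectifiable current, and let `Zᵢ → T` weakly. Then for every `x` and almost
every `r > 0`, `∂(T ⌞ 𝐁(x,r)) ∈ 𝓡_k(V)`: along a subsequence the variation measures converge, at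
uncharged radii `Zᵢ ⌞ B(x,r) ⇀ T ⌞ B(x,r)`, the slice masses are `≤ C fᵢ'(r)` with `∫ fᵢ' ≤ c`, so
by Fatou a further subsequence has bounded slice masses and `Current.isRectifiable_of_tendsto_boundaries`
applies. [cite: White1989, §1.2 slicing lemma p. 208 and Theorem p. 211; Federer1969, 4.2.1] -/
theorem Current.ae_isRectifiable_boundary_piece_of_tendsto_of_slices
    {K : Set V} (hK : IsCompact K) {c : ℝ≥0∞} (hc : c ≠ ⊤)
    {Z : ℕ → Current (⊤ : Opens V) (k + 1)} {T' : Current (⊤ : Opens V) (k + 1)}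
    (hZ : ∀ i, (Z i).boundary = 0 ∧ (Z i).support ⊆ K ∧ (Z i).mass ≤ c)
    (hZsl : ∀ i x, ∀ᵐ r : ℝ, 0 < r →
      (((Z i).isRepresentable_of_mass_ne_top (ne_top_of_le_ne_top hc (hZ i).2.2)).restrictSet
        (closedBall x r) measurableSet_closedBall).boundary.IsRectifiable)
    (hconv : ∀ φ, Tendsto (fun i => Z i φ) atTop (𝓝 (T' φ))) (hT'm : T'.mass ≠ ⊤) (x : V) :
    ∀ᵐ r : ℝ, 0 < r →
      ((T'.isRepresentable_of_mass_ne_top hT'm).restrictSet (closedBall x r)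
        measurableSet_closedBall).boundary.IsRectifiable := by
  classical
  set hT'r := T'.isRepresentable_of_mass_ne_top hT'm with hT'r_def
  haveI : IsFiniteMeasure T'.variation := T'.isFiniteMeasure_variation hT'm
  have hZm : ∀ i, (Z i).mass ≠ ⊤ := fun i => ne_top_of_le_ne_top hc (hZ i).2.2
  -- (1) a subsequence with weakly convergent variation measures
  obtain ⟨ι, μs, μ, hι, hμs, hμlim⟩ := Current.exists_subseq_variation_tendsto Z hc
    (fun i => (hZ i).2.2) hK (fun i => (hZ i).2.1)
  set P' : ℕ → Current (⊤ : Opens V) (k + 1) := fun j => Z (ι j) with hP'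
  have hP'conv : ∀ φ, Tendsto (fun j => P' j φ) atTop (𝓝 (T' φ)) := fun φ =>
    (hconv φ).comp hι.tendsto_atTop
  have hP'm : ∀ j, (P' j).mass ≠ ⊤ := fun j => hZm (ι j)
  have hP'r : ∀ j, (P' j).IsRepresentable := fun j => (P' j).isRepresentable_of_mass_ne_top (hP'm j)
  haveI : ∀ j, IsFiniteMeasure (P' j).variation := fun j =>
    (P' j).isFiniteMeasure_variation (hP'm j)
  -- (2) good radii
  -- (2a) uncharged spheres for `μ`, `‖T'‖` and every `‖P' j‖`
  have hcountμ : {r : ℝ | 0 < (μ : Measure V) {y | dist y x = r}}.Countable :=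
    Measure.countable_meas_level_set_pos (continuous_id.dist continuous_const).measurable
  have hcountT : {r : ℝ | 0 < T'.variation {y | dist y x = r}}.Countable :=
    Measure.countable_meas_level_set_pos (continuous_id.dist continuous_const).measurable
  have hcountP : ∀ j, {r : ℝ | 0 < (P' j).variation {y | dist y x = r}}.Countable := fun j =>
    Measure.countable_meas_level_set_pos (continuous_id.dist continuous_const).measurable
  -- (2b) rectifiable slices and closed piece = open piece, all `j`
  have hslices : ∀ᵐ r : ℝ, ∀ j, 0 < r →
      ((hP'r j).restrictSet (closedBall x r) measurableSet_closedBall).boundary.IsRectifiable ∧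
      (hP'r j).restrictSet (closedBall x r) measurableSet_closedBall =
        (hP'r j).restrictSet (ball x r) measurableSet_ball := by
    rw [ae_all_iff]; intro j
    filter_upwards [hZsl (ι j) x, (hcountP j).ae_notMem volume] with r hr hrP hr0
    refine ⟨hr hr0, ?_⟩
    simp only [not_lt, nonpos_iff_eq_zero] at hrP
    have hsph : (P' j).variation (sphere x r) = 0 := hrP
    refine (hP'r j).restrictSet_congr_ae _ _ ?_
    have : (ball x r : Set V) =ᵐ[(P' j).variation] (closedBall x r : Set V) := by
      rw [← ball_union_sphere]
      exact (union_ae_eq_left_of_ae_eq_empty (ae_eq_empty.2 hsph)).symm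
    exact this.symm
  -- (2c) slice masses bounded by the derivative of the mass of balls, all `j`
  set f : ℕ → ℝ → ℝ := fun j s => ((P' j).variation (closedBall x s)).toReal with hf
  set C : ℝ := sliceConst k with hCdef
  have hC0 : 0 ≤ C := sliceConst_nonneg k
  set G : ℕ → ℝ → ℝ≥0∞ := fun j r => ENNReal.ofReal (C * deriv (f j) r) with hG
  have hGm : ∀ j, Measurable (G j) := fun j =>
    ((measurable_deriv (f j)).const_mul C).ennreal_ofReal
  have hmassG : ∀ᵐ r : ℝ, ∀ j, 0 < r →
      (((P' j).isRepresentable_of_mass_ne_top (hP'm j)).restrictSet (closedBall x r)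
        measurableSet_closedBall).boundary.mass ≤ G j r := by
    rw [ae_all_iff]; intro j
    filter_upwards [(P' j).ae_mass_boundary_piece_le_deriv (hP'm j) (hZ (ι j)).1 x] with r hr hr0
    exact (hr hr0).2
  -- (2d) Fatou: `liminfⱼ G j r < ∞` for a.e. `r > 0`
  have hGint : ∀ j (N : ℕ), ∫⁻ r in Ioo (0 : ℝ) N, G j r ≤ ENNReal.ofReal (C * c.toReal) := by
    intro j N
    have hmono : Monotone (f j) := fun a a' haa =>
      ENNReal.toReal_mono (measure_ne_top _ _) (measure_mono (closedBall_subset_closedBall haa))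
    have hfle : ∀ s, f j s ≤ c.toReal := fun s =>
      ENNReal.toReal_mono hc (((P' j).variation_le_mass _).trans (hZ (ι j)).2.2)
    have hf0 : ∀ s, 0 ≤ f j s := fun s => ENNReal.toReal_nonneg
    calc ∫⁻ r in Ioo (0 : ℝ) N, G j r
        = ∫⁻ r in Ioo (0 : ℝ) N, ENNReal.ofReal C * ENNReal.ofReal (deriv (f j) r) := by
          refine lintegral_congr fun r => ?_
          rw [hG]; exact ENNReal.ofReal_mul hC0
      _ = ENNReal.ofReal C * ∫⁻ r in Ioo (0 : ℝ) N, ENNReal.ofReal (deriv (f j) r) :=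
          lintegral_const_mul _ (measurable_deriv (f j)).ennreal_ofReal
      _ ≤ ENNReal.ofReal C * ENNReal.ofReal (f j N - f j 0) := by
          gcongr; exact Monotone.lintegral_deriv_le hmono 0 N
      _ ≤ ENNReal.ofReal C * ENNReal.ofReal c.toReal := by
          gcongr; linarith [hfle N, hf0 0]
      _ = ENNReal.ofReal (C * c.toReal) := (ENNReal.ofReal_mul hC0).symm
  have hfatou : ∀ N : ℕ, ∀ᵐ r : ℝ, r ∈ Ioo (0 : ℝ) N → liminf (fun j => G j r) atTop < ⊤ := by
    intro N
    have hmeas : Measurable fun r => liminf (fun j => G j r) atTop := Measurable.liminf hGm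
    have hle : ∫⁻ r in Ioo (0 : ℝ) N, liminf (fun j => G j r) atTop ≤ ENNReal.ofReal (C * c.toReal) :=
      (lintegral_liminf_le hGm).trans
        (liminf_le_of_frequently_le' (Eventually.of_forall fun j => hGint j N).frequently)
    have := ae_lt_top' hmeas.aemeasurable (ne_top_of_le_ne_top ENNReal.ofReal_ne_top hle)
    exact (ae_restrict_iff' measurableSet_Ioo).1 this
  rw [← ae_all_iff] at hfatou
  -- (3) at a good radius
  filter_upwards [hcountμ.ae_notMem volume, hcountT.ae_notMem volume, hslices, hmassG, hfatou]
    with r hrμ hrT hsl hmG hfat hr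
  simp only [not_lt, nonpos_iff_eq_zero] at hrμ hrT
  have hsphμ : (μ : Measure V) (sphere x r) = 0 := hrμ
  have hsphT : T'.variation (sphere x r) = 0 := hrT
  -- the closed and open pieces of `T'` agree
  have heqT : hT'r.restrictSet (closedBall x r) measurableSet_closedBall =
      hT'r.restrictSet (ball x r) measurableSet_ball := by
    refine hT'r.restrictSet_congr_ae _ _ ?_
    have : (ball x r : Set V) =ᵐ[T'.variation] (closedBall x r : Set V) := by
      rw [← ball_union_sphere]
      exact (union_ae_eq_left_of_ae_eq_empty (ae_eq_empty.2 hsphT)).symm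
    exact this.symm
  rw [heqT]
  -- (3a) `∂(P' j ⌞ B) ⇀ ∂(T' ⌞ B)`
  have hfront : (μ : Measure V) (frontier (ball x r)) = 0 := by
    rw [frontier_ball x hr.ne']; exact hsphμ
  have hconvB : ∀ φ : TestForm (⊤ : Opens V) k,
      Tendsto (fun j => ((hP'r j).restrictSet (ball x r) measurableSet_ball).boundary φ) atTop
        (𝓝 ((hT'r.restrictSet (ball x r) measurableSet_ball).boundary φ)) := fun φ => by
    simp only [Current.boundary_apply]
    exact Current.tendsto_restrictSet_apply_of_tendsto hP'r hT'r hT'm hP'conv hμs hμlim isOpen_ball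
      hfront _
  -- (3b) a subsequence with bounded slice masses
  obtain ⟨N, hN⟩ := exists_nat_gt r
  have hL : liminf (fun j => G j r) atTop < ⊤ := hfat N ⟨hr, hN⟩
  set L := liminf (fun j => G j r) atTop with hLdef
  have hfreq : ∃ᶠ j in atTop, G j r < L + 1 :=
    frequently_lt_of_liminf_lt (by isBoundedDefault) (ENNReal.lt_add_right hL.ne one_ne_zero)
  obtain ⟨κ, hκ, hκG⟩ := extraction_of_frequently_atTop hfreq
  -- (3c) the closure theorem along the subsequence
  set Q : ℕ → Current (⊤ : Opens V) (k + 1) := fun l =>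
    (hP'r (κ l)).restrictSet (ball x r) measurableSet_ball with hQ
  have hQ1 : ∀ l, (Q l).boundary.IsRectifiable := fun l => by
    have h := (hsl (κ l) hr).1
    rwa [(hsl (κ l) hr).2] at h
  have hQ2 : ∀ l, (Q l).boundary.support ⊆ closedBall x r := fun l =>
    (Current.support_boundary_subset _).trans
      (((hP'r (κ l)).support_restrictSet_subset_closure measurableSet_ball).trans
        (by rw [closure_ball x hr.ne']))
  have hQ3 : ∀ l, (Q l).boundary.mass ≤ L + 1 := fun l => by
    have h1 := hmG (κ l) hr
    have h2 : ((P' (κ l)).isRepresentable_of_mass_ne_top (hP'm (κ l))).restrictSet (closedBall x r)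
        measurableSet_closedBall = Q l := by
      rw [hQ]
      exact (hsl (κ l) hr).2
    rw [h2] at h1
    exact h1.trans (hκG l).le
  have hQconv : ∀ φ, Tendsto (fun l => (Q l).boundary φ) atTop
      (𝓝 ((hT'r.restrictSet (ball x r) measurableSet_ball).boundary φ)) := fun φ =>
    (hconvB φ).comp hκ.tendsto_atTop
  exact Current.isRectifiable_of_tendsto_boundaries k (closedBall x r) (isCompact_closedBall x r)
    (L + 1) (ENNReal.add_ne_top.2 ⟨hL.ne, ENNReal.one_ne_top⟩) Q _ (fun l => ⟨hQ1 l, hQ2 l, hQ3 l⟩)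
    hQconv

end Slices

/-! ### The theorem -/

section Main

/-- **Weak limits of cycles with rectifiable sphere slices are rectifiable.** Let `Zᵢ` be
`(k+1)`-cycles (`k + 1 ≤ dim V`) with `spt Zᵢ ⊆ K` compact and `𝐌(Zᵢ) ≤ c < ∞`, such that for
every `i`, every centre `x` and almost every `r > 0` the slice `∂(Zᵢ ⌞ 𝐁(x,r))` is a rectifiable
`k`-current, and suppose `Zᵢ → T` weakly. Then `T ∈ 𝓡_{k+1}(V)`: the limit is a cycle of finite mass
with compact support whose sphere slices are rectifiable
(`Current.ae_isRectifiable_boundary_piece_of_tendsto_of_slices`), and a boundaryless current with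
rectifiable slices is rectifiable (`Current.isRectifiable_of_cycle_of_slices`). With `Zᵢ`
rectifiable this is the cycle case of White's closure theorem.
[cite: White1989, §1.5 p. 210 and Theorem p. 211; Federer1969, 4.2.16] -/
theorem Current.isRectifiable_of_tendsto_cycles_of_slices (hkn : k + 1 ≤ Module.finrank ℝ V)
    {K : Set V} (hK : IsCompact K) {c : ℝ≥0∞} (hc : c ≠ ⊤)
    {Z : ℕ → Current (⊤ : Opens V) (k + 1)} {T' : Current (⊤ : Opens V) (k + 1)}
    (hZ : ∀ i, (Z i).boundary = 0 ∧ (Z i).support ⊆ K ∧ (Z i).mass ≤ c)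
    (hZsl : ∀ i x, ∀ᵐ r : ℝ, 0 < r →
      (((Z i).isRepresentable_of_mass_ne_top (ne_top_of_le_ne_top hc (hZ i).2.2)).restrictSet
        (closedBall x r) measurableSet_closedBall).boundary.IsRectifiable)
    (hconv : ∀ φ, Tendsto (fun i => Z i φ) atTop (𝓝 (T' φ))) : T'.IsRectifiable := by
  -- `T'` is a cycle of finite mass with compact support
  have hT'm : T'.mass ≠ ⊤ :=
    ne_top_of_le_ne_top hc (Current.mass_le_of_tendsto hconv fun i => (hZ i).2.2)
  have hT'0 : T'.boundary = 0 :=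
    Current.boundary_eq_zero_of_tendsto (l := atTop) hconv fun i => (hZ i).1
  have hT'K : T'.support ⊆ K :=
    Current.support_subset_of_tendsto hconv hK.isClosed fun i => (hZ i).2.1
  have hT'c : IsCompact T'.support := T'.isCompact_support_of_subset hK (subset_univ _) hT'K
  -- its sphere slices are rectifiable
  have hslices : ∀ x, ∀ᵐ r : ℝ, 0 < r →
      ((T'.isRepresentable_of_mass_ne_top hT'm).restrictSet (closedBall x r)
        measurableSet_closedBall).boundary.IsRectifiable := fun x =>
    Current.ae_isRectifiable_boundary_piece_of_tendsto_of_slices hK hc hZ hZsl hconv hT'm x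
  exact Current.isRectifiable_of_cycle_of_slices hkn
    (fun K' hK' c' hc' Q Z' hQ hQc =>
      Current.isRectifiable_of_tendsto_boundaries k K' hK' c' hc' Q Z' hQ hQc)
    hT'm hT'0 hT'c hslices

/-- **A cycle with rectifiable sphere slices is rectifiable**, unconditional form of
`Current.isRectifiable_of_cycle_of_slices` (the induction hypothesis being
`Current.isRectifiable_of_tendsto_boundaries`): a `(k+1)`-cycle (`k + 1 ≤ dim V`) of finite mass
and compact support such that `∂(T ⌞ 𝐁(x,r)) ∈ 𝓡_k(V)` for every centre `x` and almost every
`r > 0` is a rectifiable current. [cite: White1989, §1.5 p. 210 and Theorem p. 211] -/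
theorem Current.isRectifiable_of_cycle_of_slices' (hkn : k + 1 ≤ Module.finrank ℝ V)
    {T' : Current (⊤ : Opens V) (k + 1)} (hT'm : T'.mass ≠ ⊤) (hT'0 : T'.boundary = 0)
    (hT'c : IsCompact T'.support)
    (hslices : ∀ x, ∀ᵐ r : ℝ, 0 < r →
      ((T'.isRepresentable_of_mass_ne_top hT'm).restrictSet (closedBall x r)
        measurableSet_closedBall).boundary.IsRectifiable) :
    T'.IsRectifiable :=
  Current.isRectifiable_of_cycle_of_slices hkn
    (fun K' hK' c' hc' Q Z' hQ hQc =>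
      Current.isRectifiable_of_tendsto_boundaries k K' hK' c' hc' Q Z' hQ hQc)
    hT'm hT'0 hT'c hslices

end Main

end Literature.Geometry.GeometricMeasureTheory
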